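import Summits.AnomalousDissipation.AnomalousDissipation.Theorems.BaireTransferDenseLoudDesignerForcesErgodicModelMixedDerivativeFieldCont

/-!
# The mixed field `Ẇ = ∂ₜ∂_y g = ∂_y∂ₜ g` of the smooth model (registered tools stub S6c₂ `stub_modelMixedDerivativeFieldTools`
# of the crux `DenseLoudDesignerForces`, line ergodic-budget-selection-closing, block N-R)

Summit-side assembly.  For the model map `g = F.modelMap ν xF U'` with the tube property, joint continuity, per-time smoothness,
joint operator-norm continuity of `W(t, y) = fderiv (g t ·) y` on `(0, 3] × U` and classical orbits for positive times
(`hclass`), on `O = (0, 3) × U`: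

1. `t ↦ W(t, y)` is differentiable in OPERATOR NORM with derivative `deriv (W(·, y)) t`;
2. `y ↦ deriv (g · y) t` is Fréchet differentiable with that same derivative;
3. the mixed field is jointly continuous on `O` in operator norm.

Route ("`∂_y∂ₜ` first, then `∂ₜ∂_y` by the fundamental theorem of calculus"; no second time derivatives of linearised solutions
and no identification of `W(t, y)h` with classical linearised solutions are needed):
* the time-derivative field is `V(s, y) = deriv (g · y) s = S([∂ₜu_y(s)] − [Δ∂ₜu_y(s)])` (`hasDerivAt_modelMap`), continuous in
  `s` (`continuousOn_deriv_modelMap`);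
* around every base point the candidate operator field `Φ` (`exists_mixedOp`) is the Fréchet derivative of `V(s, ·)`
  (`hasFDerivAt_timeField_frame`: Gevrey–Lipschitz dependence of the orbits, `Torus.exists_h1_linearisationRemainder_le`, Gevrey
  interpolation) and is continuous at the base point in operator norm (`mixedOp_norm_sub_le`:
  `Torus.exists_h1_linearisation_sub_le`), so `M(s, y) = fderiv (V(s, ·)) y` exists on `O` and is jointly continuous there;
* the strong Schwarz theorem `Literature.Analysis.Calculus.hasDerivAt_fderiv_of_hasFDerivAt_deriv` then gives
  `HasDerivAt (W(·, y)) (M(t, y)) t`, whence all three conjuncts.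
-/

set_option linter.dupNamespace false

noncomputable section

open Set Function MeasureTheory Filter Metric
open scoped InnerProductSpace RealInnerProductSpace Topology ContDiff

namespace Summit.AnomalousDissipation.AnomalousDissipation.Theorems.DenseLoudDesignerForces.Ergodic

open Literature.Analysis.FunctionSpaces Literature.Analysis.FunctionSpaces.Torus
open Literature.Analysis.FluidPDE Literature.Analysis.FluidPDE.Torus
open Summit.AnomalousDissipation.AnomalousDissipation.Theses.BaireTransfer
open Summit.AnomalousDissipation.AnomalousDissipation.Theorems.DenseLoudDesignerForces.Negative

/-- Metric form of continuity within a set for maps into a normed group (converse direction): if for every `ε₀ > 0` there is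
`θ > 0` with `‖f x' − f x‖ ≤ ε₀` for `x' ∈ s`, `dist x' x < θ`, then `f` is continuous within `s` at `x`. [folklore] -/
theorem continuousWithinAt_of_forall_norm_sub_le {X G : Type*} [PseudoMetricSpace X] [NormedAddCommGroup G] {f : X → G}
    {s : Set X} {x : X} (h : ∀ ε₀ > (0 : ℝ), ∃ θ > (0 : ℝ), ∀ x' ∈ s, dist x' x < θ → ‖f x' - f x‖ ≤ ε₀) :
    ContinuousWithinAt f s x := by
  rw [Metric.continuousWithinAt_iff]
  intro ε₀ hε₀
  obtain ⟨θ, hθ, h'⟩ := h (ε₀ / 2) (half_pos hε₀)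
  refine ⟨θ, hθ, ?_⟩
  intro x' hx' hd
  rw [dist_eq_norm]
  exact (h' x' hx' hd).trans_lt (half_lt_self hε₀)

section Assembly

variable {S : Finset (Fin 3 → ℤ)} {c : ↥S → (EuclideanSpace ℂ (Fin 3))} {ν : ℝ} (F : ModelFrame) (xF : Hsp) {U U' : Set Hsp}
  (u : Hsp → ℝ → (UnitAddTorus (Fin 3)) → (EuclideanSpace ℝ (Fin 3))) (p : Hsp → ℝ → (UnitAddTorus (Fin 3)) → ℝ)

-- operator norms on `Hsp →L[ℝ] Hsp` through the submodule `Hsp` are slow to synthesise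
set_option synthInstance.maxHeartbeats 400000 in
/-- **The local data at a base point `(t, y₀) ∈ O`**: warm-up `a = t/4`, the uniform Gevrey level `(σ₁, C₁)` of the orbits on
`[2a, 3]` (`exists_gevrey_modelMap`), the Gevrey–Lipschitz constant `(σ₂, C₂)` on `[3a, 3]` (`exists_gevrey_sub_modelMap`), the
Lipschitz box `(ε, ρ, L)` of `y ↦ g r y` around `(r₀, y₀)`, `r₀ = t − a` (`exists_box_lipschitz_modelMap`), and the operator
field `Φ` of `exists_mixedOp`; the base point is admissible. [folklore] -/
theorem exists_localData (hν : 0 < ν) (hsol : ∀ y ∈ U, IsClassicalNSSolutionOn (Ioc 0 3) ν (fun _ => force S c) (u y) (p y))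
    (hzm : ∀ y ∈ U, ∀ t ∈ Ioc (0 : ℝ) 3, HasZeroMean (u y t)) {E₂ : ℝ} (hE : ∀ y ∈ U, ∀ t ∈ Ioc (0 : ℝ) 3, gradNormSq (u y t) ≤ E₂)
    (hSu : ∀ y ∈ U, ∀ t ∈ Ioc (0 : ℝ) 3, F.S (F.modelMap ν xF U' t y) = stateOf (u y t)) (hU : IsOpen U)
    (hsmooth : ∀ t ∈ Icc (0 : ℝ) 3, ContDiffOn ℝ ∞ (fun y => F.modelMap ν xF U' t y) U)
    (hW : ContinuousOn (fun q : ℝ × Hsp => fderiv ℝ (fun y => F.modelMap ν xF U' q.1 y) q.2) (Ioc (0 : ℝ) 3 ×ˢ U))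
    {t : ℝ} {y₀ : Hsp} (ht : t ∈ Ioo (0 : ℝ) 3) (hy₀ : y₀ ∈ U) :
    ∃ (a σ₁ C₁ σ₂ C₂ ε ρ L r₀ : ℝ) (Φ : ℝ → Hsp → (Hsp →L[ℝ] Hsp)), 0 < a ∧ 0 < σ₁ ∧ 0 < σ₂ ∧ 0 ≤ C₂ ∧
      (∀ y ∈ U, ∀ s ∈ Icc (2 * a) 3, ∀ S' : Finset (Fin 3 → ℤ), ∑ k ∈ S', Real.exp (2 * σ₁ * Real.sqrt (freqNormSq k)) *
        ‖UnitAddTorus.mFourierCoeff (EuclideanSpace.complexify ∘ u y s) k‖ ^ 2 ≤ C₁) ∧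
      (∀ y ∈ U, ∀ y' ∈ U, ∀ s ∈ Icc (3 * a) 3, ∀ S' : Finset (Fin 3 → ℤ),
        ∑ k ∈ S', Real.exp (2 * σ₂ * Real.sqrt (freqNormSq k)) *
          ‖UnitAddTorus.mFourierCoeff (EuclideanSpace.complexify ∘ fun x => u y s x - u y' s x) k‖ ^ 2 ≤
          C₂ * ‖F.modelMap ν xF U' (s - a) y - F.modelMap ν xF U' (s - a) y'‖ ^ 2) ∧
      0 < ρ ∧ ball y₀ ρ ⊆ U ∧ Icc (r₀ - ε) (r₀ + ε) ⊆ Ioo (0 : ℝ) 3 ∧ 0 < ε ∧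
      (∀ r ∈ Icc (r₀ - ε) (r₀ + ε), ∀ y ∈ ball y₀ ρ, ∀ y' ∈ ball y₀ ρ,
        ‖F.modelMap ν xF U' r y - F.modelMap ν xF U' r y'‖ ≤ L * ‖y - y'‖) ∧
      (∀ s ∈ Icc (3 * a) 3, s - a ∈ Icc (r₀ - ε) (r₀ + ε) → ∀ y ∈ ball y₀ (ρ / 2),
        ∀ (h : Hsp) (w : (UnitAddTorus (Fin 3)) → (EuclideanSpace ℝ (Fin 3))), IsSmooth w → IsDivFree w → HasZeroMean w →
          stateOf w = F.S (fderiv ℝ (fun y' => F.modelMap ν xF U' s y') y h) →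
          Φ s y h = F.S (stateOf (fun x => (ν • laplacian w x - (convect (u y s) w x + convect w (u y s) x)) -
              Torus.gradient (invLaplacian (divergence fun z => ν • laplacian w z - (convect (u y s) w z + convect w (u y s) z))) x) -
            stateOf (laplacian fun x => (ν • laplacian w x - (convect (u y s) w x + convect w (u y s) x)) -
              Torus.gradient (invLaplacian (divergence fun z => ν • laplacian w z - (convect (u y s) w z + convect w (u y s) z))) x))) ∧
      t ∈ Icc (3 * a) 3 ∧ t - a = r₀ ∧ t = 4 * a := by
  set a : ℝ := t / 4 with ha
  have ha0 : 0 < a := by rw [ha]; linarith [ht.1]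
  obtain ⟨σ₁, hσ₁, C₁, hG₁⟩ := exists_gevrey_modelMap u p hν hsol hzm hE ha0
  obtain ⟨σ₂, hσ₂, C₂, hC₂, hLipG⟩ := exists_gevrey_sub_modelMap F xF u p hν hsol hzm hSu ha0 hσ₁ hG₁
  have hr₀ : t - a ∈ Ioo (0 : ℝ) 3 := ⟨by rw [ha]; linarith [ht.1], by linarith [ht.2, ha0]⟩
  obtain ⟨ε, hε, ρ, hρ, L, -, hIcc, hball, hLip⟩ := exists_box_lipschitz_modelMap F xF (ν := ν) (U' := U') hU hsmooth hW hr₀ hy₀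
  obtain ⟨Φ, hΦ⟩ := exists_mixedOp F xF u p hsol hzm hSu hU hsmooth ha0 hσ₁ hσ₂ hC₂ hG₁ hLipG hρ hball hLip
  refine ⟨a, σ₁, C₁, σ₂, C₂, ε, ρ, L, t - a, Φ, ha0, hσ₁, hσ₂, hC₂, hG₁, hLipG, hρ, hball, hIcc, hε, hLip, hΦ,
    ⟨by rw [ha]; linarith [ht.1], ht.2.le⟩, rfl, by rw [ha]; ring⟩

/-- **The time-derivative field through the classical solutions is Fréchet differentiable in the datum at every point of `O`.**
[folklore] -/
theorem differentiableAt_timeField (hν : 0 < ν) (hsol : ∀ y ∈ U, IsClassicalNSSolutionOn (Ioc 0 3) ν (fun _ => force S c) (u y) (p y))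
    (hzm : ∀ y ∈ U, ∀ t ∈ Ioc (0 : ℝ) 3, HasZeroMean (u y t)) {E₂ : ℝ} (hE : ∀ y ∈ U, ∀ t ∈ Ioc (0 : ℝ) 3, gradNormSq (u y t) ≤ E₂)
    (hSu : ∀ y ∈ U, ∀ t ∈ Ioc (0 : ℝ) 3, F.S (F.modelMap ν xF U' t y) = stateOf (u y t)) (hU : IsOpen U)
    (hsmooth : ∀ t ∈ Icc (0 : ℝ) 3, ContDiffOn ℝ ∞ (fun y => F.modelMap ν xF U' t y) U)
    (hW : ContinuousOn (fun q : ℝ × Hsp => fderiv ℝ (fun y => F.modelMap ν xF U' q.1 y) q.2) (Ioc (0 : ℝ) 3 ×ˢ U))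
    {t : ℝ} {y₀ : Hsp} (ht : t ∈ Ioo (0 : ℝ) 3) (hy₀ : y₀ ∈ U) :
    DifferentiableAt ℝ (fun y' => F.S (stateOf (Torus.timeDeriv (u y') t) - stateOf (laplacian (Torus.timeDeriv (u y') t)))) y₀ := by
  obtain ⟨a, σ₁, C₁, σ₂, C₂, ε, ρ, L, r₀, Φ, -, hσ₁, hσ₂, hC₂, hG₁, hLipG, hρ, hball, -, hε, hLip, hΦ, htI, htr, -⟩ :=
    exists_localData F xF u p hν hsol hzm hE hSu hU hsmooth hW ht hy₀
  have htr' : t - a ∈ Icc (r₀ - ε) (r₀ + ε) := by rw [htr]; exact ⟨by linarith, by linarith⟩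
  exact (hasFDerivAt_timeField_frame F xF u p hsol hzm hSu hU hsmooth hσ₁ hσ₂ hC₂ hG₁ hLipG hρ hball hLip hΦ htI ht.1 ht.2 htr'
    (mem_ball_self (half_pos hρ))).differentiableAt

-- operator norms on `Hsp →L[ℝ] Hsp` through the submodule `Hsp` are slow to synthesise
set_option synthInstance.maxHeartbeats 400000 in
/-- **The `y`-derivative of the time-derivative field is jointly continuous on `O` in operator norm**: near a base point it is the
operator field `Φ` of the base point's local data (uniqueness of the Fréchet derivative, `hasFDerivAt_timeField_frame` at the nearby
admissible points), which is continuous at the base point (`mixedOp_norm_sub_le`). [folklore] -/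
theorem continuousOn_fderiv_timeField (hν : 0 < ν)
    (hsol : ∀ y ∈ U, IsClassicalNSSolutionOn (Ioc 0 3) ν (fun _ => force S c) (u y) (p y))
    (hzm : ∀ y ∈ U, ∀ t ∈ Ioc (0 : ℝ) 3, HasZeroMean (u y t)) {E₂ : ℝ} (hE : ∀ y ∈ U, ∀ t ∈ Ioc (0 : ℝ) 3, gradNormSq (u y t) ≤ E₂)
    (hSu : ∀ y ∈ U, ∀ t ∈ Ioc (0 : ℝ) 3, F.S (F.modelMap ν xF U' t y) = stateOf (u y t)) (hU : IsOpen U)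
    (hsmooth : ∀ t ∈ Icc (0 : ℝ) 3, ContDiffOn ℝ ∞ (fun y => F.modelMap ν xF U' t y) U)
    (hcont : ContinuousOn (fun q : ℝ × Hsp => F.modelMap ν xF U' q.1 q.2) (Icc (0 : ℝ) 3 ×ˢ U))
    (hW : ContinuousOn (fun q : ℝ × Hsp => fderiv ℝ (fun y => F.modelMap ν xF U' q.1 y) q.2) (Ioc (0 : ℝ) 3 ×ˢ U)) :
    ContinuousOn (fun q : ℝ × Hsp => fderiv ℝ (fun y' => F.S (stateOf (Torus.timeDeriv (u y') q.1) -
      stateOf (laplacian (Torus.timeDeriv (u y') q.1)))) q.2) (Ioo (0 : ℝ) 3 ×ˢ U) := by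
  rintro ⟨t, y₀⟩ ⟨ht, hy₀⟩
  obtain ⟨a, σ₁, C₁, σ₂, C₂, ε, ρ, L, r₀, Φ, ha, hσ₁, hσ₂, hC₂, hG₁, hLipG, hρ, hball, -, hε, hLip, hΦ, htI, htr, hta⟩ :=
    exists_localData F xF u p hν hsol hzm hE hSu hU hsmooth hW ht hy₀
  have htr' : t - a ∈ Icc (r₀ - ε) (r₀ + ε) := by rw [htr]; exact ⟨by linarith, by linarith⟩
  -- near the base point, the derivative is `Φ`
  have hderiv : ∀ (s : ℝ) (y : Hsp), s ∈ Icc (3 * a) 3 → s < 3 → s - a ∈ Icc (r₀ - ε) (r₀ + ε) → y ∈ ball y₀ (ρ / 2) →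
      fderiv ℝ (fun y' => F.S (stateOf (Torus.timeDeriv (u y') s) - stateOf (laplacian (Torus.timeDeriv (u y') s)))) y = Φ s y :=
    fun s y hs hs3 hsr hy => (hasFDerivAt_timeField_frame F xF u p hsol hzm hSu hU hsmooth hσ₁ hσ₂ hC₂ hG₁ hLipG hρ hball hLip hΦ hs
      (by linarith [hs.1]) hs3 hsr hy).fderiv
  refine continuousWithinAt_of_forall_norm_sub_le (G := Hsp →L[ℝ] Hsp)
    (f := fun q : ℝ × Hsp => fderiv ℝ (fun y' => F.S (stateOf (Torus.timeDeriv (u y') q.1) -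
      stateOf (laplacian (Torus.timeDeriv (u y') q.1)))) q.2) fun ε₀ hε₀ => ?_
  obtain ⟨θ, hθ, hθΦ⟩ := mixedOp_norm_sub_le F xF u p hsol hzm hSu hU hsmooth hcont hW ha hσ₁ hσ₂ hC₂ hG₁ hLipG hρ hball hLip hΦ htI
    htr' hε₀
  -- the neighbourhood: admissible, `s < 3`, and within `θ`
  refine ⟨min θ (min (min a ε) (min (ρ / 2) (3 - t))),
    lt_min hθ (lt_min (lt_min ha hε) (lt_min (half_pos hρ) (by linarith [ht.2]))), ?_⟩
  rintro ⟨s, y⟩ ⟨hs, hy⟩ hd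
  rw [Prod.dist_eq, max_lt_iff, Real.dist_eq, dist_eq_norm] at hd
  obtain ⟨hds, hdy⟩ := hd
  have hst : |s - t| < θ := hds.trans_le (min_le_left _ _)
  have hsa : |s - t| < a := (hds.trans_le (min_le_right _ _)).trans_le ((min_le_left _ _).trans (min_le_left _ _))
  have hsε : |s - t| < ε := (hds.trans_le (min_le_right _ _)).trans_le ((min_le_left _ _).trans (min_le_right _ _))
  have hs3t : |s - t| < 3 - t := (hds.trans_le (min_le_right _ _)).trans_le ((min_le_right _ _).trans (min_le_right _ _))
  have hyt : ‖y - y₀‖ < θ := hdy.trans_le (min_le_left _ _)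
  have hyρ : ‖y - y₀‖ < ρ / 2 := (hdy.trans_le (min_le_right _ _)).trans_le ((min_le_right _ _).trans (min_le_left _ _))
  obtain ⟨h1, h2⟩ := abs_lt.1 hsa
  obtain ⟨h3, h4⟩ := abs_lt.1 hsε
  obtain ⟨-, h6⟩ := abs_lt.1 hs3t
  have hsI : s ∈ Icc (3 * a) 3 := ⟨by linarith, by linarith⟩
  have hs3 : s < 3 := by linarith
  have hsr : s - a ∈ Icc (r₀ - ε) (r₀ + ε) := ⟨by linarith, by linarith⟩
  have hyb : y ∈ ball y₀ (ρ / 2) := by rwa [mem_ball, dist_eq_norm]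
  dsimp only
  rw [hderiv s y hsI hs3 hsr hyb, hderiv t y₀ htI ht.2 htr' (mem_ball_self (half_pos hρ))]
  exact hθΦ s y hsI hsr hyb hst hyt

end Assembly

-- operator norms on `Hsp →L[ℝ] Hsp` through the submodule `Hsp` are slow to synthesise
set_option synthInstance.maxHeartbeats 400000 in
/-- **Tools stub S6c₂ — THE MIXED FIELD `Ẇ = ∂ₜ ∂_y g = ∂_y ∂ₜ g` (block N-R, inputs of S4b).**  On `O := Ioo 0 3 ×ˢ U`: the operator field
`W(t,y) := fderiv (g t ·) y` is differentiable in `t` IN OPERATOR NORM with derivative `Ẇ(t,y) := deriv (W(·,y)) t`; the time-derivative field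
`y ↦ deriv (g · y) t` is Fréchet differentiable in `y` with derivative `Ẇ(t,y)`; and `Ẇ` is jointly continuous on `O` in operator norm.  Proof
("`∂_y∂ₜ` first"): the time-derivative field is the frame of `∂ₜu_y` (`hasDerivAt_modelMap`), it is Fréchet differentiable in `y`
(`differentiableAt_timeField`: Gevrey–Lipschitz dependence of the orbits after a warm-up, the `H¹` linearisation remainder of the projected NS
vector field on Gevrey balls, Gevrey interpolation) with a jointly continuous derivative field (`continuousOn_fderiv_timeField`), and the strong
Schwarz theorem `Literature.Analysis.Calculus.hasDerivAt_fderiv_of_hasFDerivAt_deriv` (fundamental theorem of calculus in `y`-derivatives)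
gives `∂ₜ W = ∂_y ∂ₜ g`. [folklore] -/
theorem stub_modelMixedDerivativeFieldTools {S : Finset (Fin 3 → ℤ)} {c : ↥S → (EuclideanSpace ℂ (Fin 3))} {ν : ℝ} (hν : 0 < ν)
    (F : ModelFrame) (xF : Hsp) (hxF : F.S xF = stateOf (force S c)) {U U' : Set Hsp} (hU : IsOpen U) (hU' : IsOpen U')
    (hbdd : Bornology.IsBounded U') (hUU' : U ⊆ U')
    (htube : ∀ y ∈ U, ∀ t ∈ Icc (0 : ℝ) 3, ∃ (ht : 0 ≤ t) (z : C(Icc (0 : ℝ) t, Hsp)),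
      F.IsMild ν xF ht y z ∧ (∀ r, z r ∈ U') ∧ F.modelMap ν xF U' t y = z ⟨t, ht, le_rfl⟩)
    (hcont : ContinuousOn (fun q : ℝ × Hsp => F.modelMap ν xF U' q.1 q.2) (Icc (0 : ℝ) 3 ×ˢ U))
    (hsmooth : ∀ t ∈ Icc (0 : ℝ) 3, ContDiffOn ℝ ∞ (fun y => F.modelMap ν xF U' t y) U)
    (hW : ContinuousOn (fun q : ℝ × Hsp => fderiv ℝ (fun y => F.modelMap ν xF U' q.1 y) q.2) (Ioc (0 : ℝ) 3 ×ˢ U)) {E₂ : ℝ}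
    (hclass : ∀ y ∈ U, ∃ (u : ℝ → (UnitAddTorus (Fin 3)) → (EuclideanSpace ℝ (Fin 3))) (p : ℝ → (UnitAddTorus (Fin 3)) → ℝ),
      IsClassicalNSSolutionOn (Ioc 0 3) ν (fun _ => force S c) u p ∧ (∀ t ∈ Ioc (0 : ℝ) 3, HasZeroMean (u t)) ∧
      (∀ t ∈ Ioc (0 : ℝ) 3, gradNormSq (u t) ≤ E₂) ∧ ∀ t ∈ Ioc (0 : ℝ) 3, F.S (F.modelMap ν xF U' t y) = stateOf (u t)) :
    (∀ q ∈ Ioo (0 : ℝ) 3 ×ˢ U, HasDerivAt (fun t => fderiv ℝ (fun y => F.modelMap ν xF U' t y) q.2)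
      (deriv (fun t => fderiv ℝ (fun y => F.modelMap ν xF U' t y) q.2) q.1) q.1) ∧
    (∀ q ∈ Ioo (0 : ℝ) 3 ×ˢ U, HasFDerivAt (fun y => deriv (fun t => F.modelMap ν xF U' t y) q.1)
      (deriv (fun t => fderiv ℝ (fun y => F.modelMap ν xF U' t y) q.2) q.1) q.2) ∧
    ContinuousOn (fun q : ℝ × Hsp => deriv (fun t => fderiv ℝ (fun y => F.modelMap ν xF U' t y) q.2) q.1) (Ioo (0 : ℝ) 3 ×ˢ U) := by
  -- the tube property, the bounded set `U'` and the frame forcing are part of the registered interface; they are not needed here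
  have _ := hxF; have _ := hU'; have _ := hbdd; have _ := hUU'; have _ := htube
  choose! u p hsol hzm hE hSu using hclass
  -- ### the time-derivative field and its `y`-derivative field
  have hO : IsOpen (Ioo (0 : ℝ) 3 ×ˢ U) := isOpen_Ioo.prod hU
  have hVeq : ∀ y ∈ U, ∀ s ∈ Ioo (0 : ℝ) 3, ∀ᶠ y' in 𝓝 y, deriv (fun r => F.modelMap ν xF U' r y') s =
      F.S (stateOf (Torus.timeDeriv (u y') s) - stateOf (laplacian (Torus.timeDeriv (u y') s))) := by
    intro y hy s hs
    filter_upwards [hU.mem_nhds hy] with y' hy'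
    exact (hasDerivAt_modelMap F xF u p hsol hzm hSu hy' hs).deriv
  have hV : ∀ q ∈ Ioo (0 : ℝ) 3 ×ˢ U, HasFDerivAt (fun y => deriv (fun r => F.modelMap ν xF U' r y) q.1)
      (fderiv ℝ (fun y => deriv (fun r => F.modelMap ν xF U' r y) q.1) q.2) q.2 := by
    rintro ⟨s, y⟩ ⟨hs, hy⟩
    have hd := differentiableAt_timeField F xF u p hν hsol hzm hE hSu hU hsmooth hW hs hy
    exact ((hd.hasFDerivAt.congr_of_eventuallyEq (hVeq y hy s hs)).differentiableAt).hasFDerivAt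
  have hMc : ContinuousOn (fun q : ℝ × Hsp => fderiv ℝ (fun y => deriv (fun r => F.modelMap ν xF U' r y) q.1) q.2) (Ioo (0 : ℝ) 3 ×ˢ U) := by
    refine (continuousOn_fderiv_timeField F xF u p hν hsol hzm hE hSu hU hsmooth hcont hW).congr ?_
    rintro ⟨s, y⟩ ⟨hs, hy⟩
    exact Filter.EventuallyEq.fderiv_eq (hVeq y hy s hs)
  -- ### the strong Schwarz theorem
  have hmain := Literature.Analysis.Calculus.hasDerivAt_fderiv_of_hasFDerivAt_deriv (a := 0) (b := 3) hU
    (g := fun t y => F.modelMap ν xF U' t y) (V := fun s y => deriv (fun r => F.modelMap ν xF U' r y) s)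
    (M := fun s y => fderiv ℝ (fun y' => deriv (fun r => F.modelMap ν xF U' r y') s) y)
    (fun q hq => (hasDerivAt_modelMap F xF u p hsol hzm hSu hq.2 hq.1).differentiableAt.hasDerivAt)
    (fun y hy => continuousOn_deriv_modelMap F xF u p hsol hzm hSu hy) hV hMc
    (fun q hq => ((hsmooth q.1 (Ioo_subset_Icc_self hq.1)).contDiffAt (hU.mem_nhds hq.2)).differentiableAt (by simp))
  -- the value of the mixed field (the statement's `deriv` is read in the topological-vector-space instances of `Hsp →L[ℝ] Hsp`,
  -- the Schwarz theorem in the operator-norm ones; the two agree definitionally)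
  have hval : ∀ q ∈ Ioo (0 : ℝ) 3 ×ˢ U, deriv (fun t => fderiv ℝ (fun y => F.modelMap ν xF U' t y) q.2) q.1 =
      fderiv ℝ (fun y' => deriv (fun r => F.modelMap ν xF U' r y') q.1) q.2 := fun q hq => by
    have h := HasDerivAt.deriv (𝕜 := ℝ) (F := Hsp →L[ℝ] Hsp) (hmain q hq)
    exact h
  refine ⟨fun q hq => ?_, fun q hq => ?_, ?_⟩
  · rw [hval q hq]
    exact hmain q hq
  · rw [hval q hq]
    exact hV q hq
  · exact hMc.congr fun q hq => hval q hq

end Summit.AnomalousDissipation.AnomalousDissipation.Theorems.DenseLoudDesignerForces.Ergodic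

end
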